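import Literature.Probability.RandomPlanarGeometry.SAWEndpointRatioRateZd
import Literature.Probability.RandomPlanarGeometry.SAWPolygonUnrooting
import HarnessLib

/-!
# Madras–Slade Theorem 7.3.4(c) in every dimension, with Kesten's rates:
# the polygon two-step ratio `q_{2M+2}/q_{2M} → μ²`

Topic `Literature/Probability/RandomPlanarGeometry` (assembles `SAWEndpointRatioRateZd.lean`: Kesten's fixed-endpoint
ratio rate (7.5.2) `Zd.Kesten1963_ratioRate_endpoint_allDim` and the lower envelope
`EndpointEnvelopeZd.exists_exp_mul_pow_le_countAt`; `SAWPolygonGrowth.lean`: (3.2.1) in rooted form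
`#saLoops d (N+1) = 2d · c_N(0,-e₂)` (`card_saLoops_succ_eq_two_mul_countAt_eNeg`); `SAWPolygonUnrooting.lean`:
`#saLoops d N = 2N · q_N` (`PolygonConcat.card_saLoops_eq`), `q_N = PolygonConcat.polygonNumber d N` the number of
`N`-step self-avoiding polygons up to translation, Madras–Slade Definition 3.2.2).

Source: N. Madras, G. Slade, *The Self-Avoiding Walk* (1993), Theorem 7.3.4 (book p. 248): "(c)
`lim_{N→∞} q_{2N+2}/q_{2N} = μ²`", proved there from (b) (the fixed-endpoint ratio limit) and (3.2.1)
`2N q_N = 2d c_{N-1}(0,e)`.  Exactly that route is followed here, in every dimension `d ≥ 2` (as `ℤ^{d+2}`); since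
the tree's (b) carries Kesten's printed rates ((7.5.2): `-K N^{-1/3} ≤ c_{N+2}(0,x)/c_N(0,x) − μ² ≤ K N^{-1/4}`), the
polygon ratio inherits them: `q_{2M+2}/q_{2M} = (2M/(2M+2)) · c_{2M+1}(0,e)/c_{2M-1}(0,e)` and the prefactor costs
only `O(1/M)`.  The rate form for polygons is this file's bookkeeping (the book prints the limit).

## What is here (namespace `Literature.Probability.RandomPlanarGeometry.SAW.Zd`; all proved)

* `PolygonRatioZd.polygonNumber_ratio_eq` — `q_{2M+2}/q_{2M} = (2M/(2M+2)) · c_{2M+1}(0,-e₂)/c_{2M-1}(0,-e₂)` (`M ≥ 2`,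
  `c_{2M-1}(0,-e₂) > 0`);
* **`MadrasSlade1993_thm734c_rate`** — `∃ K M₀, ∀ M ≥ M₀, -K M^{-1/3} ≤ q_{2M+2}/q_{2M} − μ² ≤ K M^{-1/4}` on `ℤ^{d+2}`;
* **`MadrasSlade1993_thm734c_allDim`** — Theorem 7.3.4(c) as printed: `q_{2M+2}/q_{2M} → μ²`, every `d ≥ 2`.
-/

noncomputable section

open Filter Topology Finset Literature.Probability.LatticeModels SimpleGraph

namespace Literature.Probability.RandomPlanarGeometry.SAW.Zd

namespace PolygonRatioZd

variable {d : ℕ}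

/-- `‖-e₂‖₁ = 1`. [cite: MadrasSlade1993, §3.2, eq. (3.2.1)] -/
theorem normOne_eNeg : normOne (eNeg : Site (d + 2)) = 1 := by
  unfold normOne
  rw [Finset.sum_eq_single (1 : Fin (d + 2))]
  · simp [eNeg]
  · intro i _ hi
    simp [eNeg, Pi.single_eq_of_ne hi]
  · intro h
    exact absurd (Finset.mem_univ _) h

/-- `-e₂ ≠ 0`. [cite: MadrasSlade1993, §3.2, eq. (3.2.1)] -/
theorem eNeg_ne_zero : (eNeg : Site (d + 2)) ≠ 0 := by
  intro h
  have h1 := normOne_eNeg (d := d)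
  rw [h] at h1
  simp [normOne] at h1

/-- **(3.2.1) twice**: for `M ≥ 2` with `c_{2M-1}(0,-e₂) > 0`,
`q_{2M+2}/q_{2M} = (2M/(2M+2)) · c_{2M+1}(0,-e₂)/c_{2M-1}(0,-e₂)` (from `2N q_N = 2d c_{N-1}(0,e)` at `N = 2M+2`
and `N = 2M`). [cite: MadrasSlade1993, §3.2, eq. (3.2.1) (p. 65); Theorem 7.3.4 (c) (proof)] -/
theorem polygonNumber_ratio_eq (M : ℕ) (hM : 2 ≤ M) (hpos : 0 < countAt (d + 2) (2 * M - 1) eNeg) :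
    (PolygonConcat.polygonNumber (d + 2) (2 * M + 2) : ℝ) / PolygonConcat.polygonNumber (d + 2) (2 * M) =
      (2 * M : ℝ) / (2 * M + 2) *
        ((countAt (d + 2) (2 * M + 1) eNeg : ℝ) / countAt (d + 2) (2 * M - 1) eNeg) := by
  have h1 : 2 * (2 * M + 2) * PolygonConcat.polygonNumber (d + 2) (2 * M + 2) =
      2 * (d + 2) * countAt (d + 2) (2 * M + 1) eNeg := by
    rw [← PolygonConcat.card_saLoops_eq (by omega), card_saLoops_succ_eq_two_mul_countAt_eNeg]
  have h2 : 2 * (2 * M) * PolygonConcat.polygonNumber (d + 2) (2 * M) =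
      2 * (d + 2) * countAt (d + 2) (2 * M - 1) eNeg := by
    rw [← PolygonConcat.card_saLoops_eq (by omega)]
    have e : 2 * M = 2 * M - 1 + 1 := by omega
    conv_lhs => rw [e]
    rw [card_saLoops_succ_eq_two_mul_countAt_eNeg]
  have h1r : (2 * (2 * (M : ℝ) + 2)) * (PolygonConcat.polygonNumber (d + 2) (2 * M + 2) : ℝ) =
      2 * ((d : ℝ) + 2) * (countAt (d + 2) (2 * M + 1) eNeg : ℝ) := by exact_mod_cast h1
  have h2r : (2 * (2 * (M : ℝ))) * (PolygonConcat.polygonNumber (d + 2) (2 * M) : ℝ) =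
      2 * ((d : ℝ) + 2) * (countAt (d + 2) (2 * M - 1) eNeg : ℝ) := by exact_mod_cast h2
  have hMpos : (0 : ℝ) < M := by exact_mod_cast (show 0 < M by omega)
  have hcpos : (0 : ℝ) < countAt (d + 2) (2 * M - 1) eNeg := by exact_mod_cast hpos
  have hq1 : (PolygonConcat.polygonNumber (d + 2) (2 * M + 2) : ℝ) =
      ((d : ℝ) + 2) * countAt (d + 2) (2 * M + 1) eNeg / (2 * M + 2) := by
    rw [eq_div_iff (by positivity)]; linarith
  have hq2 : (PolygonConcat.polygonNumber (d + 2) (2 * M) : ℝ) =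
      ((d : ℝ) + 2) * countAt (d + 2) (2 * M - 1) eNeg / (2 * M) := by
    rw [eq_div_iff (by positivity)]; linarith
  rw [hq1, hq2]
  field_simp

/-- **Madras–Slade Theorem 7.3.4(c) with Kesten's rates, every dimension**: on `ℤ^{d+2}` there are `K`, `M₀`
with `-K M^{-1/3} ≤ q_{2M+2}/q_{2M} − μ² ≤ K M^{-1/4}` for all `M ≥ M₀` (from (7.5.2) at `x = -e₂` and (3.2.1); the
rate form is a corollary recorded here, the book states the limit).
[cite: MadrasSlade1993, Theorem 7.3.4 (c) (p. 248) and its proof via (3.2.1); §7.5 Notes, eq. (7.5.2)] -/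
theorem _root_.Literature.Probability.RandomPlanarGeometry.SAW.Zd.MadrasSlade1993_thm734c_rate (d : ℕ) :
    ∃ K : ℝ, ∃ M₀ : ℕ, ∀ M : ℕ, M₀ ≤ M →
      -(K * (M : ℝ) ^ (-(1 : ℝ) / 3)) ≤
          (PolygonConcat.polygonNumber (d + 2) (2 * M + 2) : ℝ) / PolygonConcat.polygonNumber (d + 2) (2 * M) -
            connectiveConstant (d + 2) ^ 2 ∧
        (PolygonConcat.polygonNumber (d + 2) (2 * M + 2) : ℝ) / PolygonConcat.polygonNumber (d + 2) (2 * M) -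
            connectiveConstant (d + 2) ^ 2 ≤ K * (M : ℝ) ^ (-(1 : ℝ) / 4) := by
  obtain ⟨K, N₀, hK⟩ := Kesten1963_ratioRate_endpoint_allDim (d := d) eNeg eNeg_ne_zero
  obtain ⟨c, N₁, -, henv⟩ := EndpointEnvelopeZd.exists_exp_mul_pow_le_countAt (d := d) eNeg eNeg_ne_zero
  set μ : ℝ := connectiveConstant (d + 2) with hμ
  have hμpos : 0 < μ := connectiveConstant_pos (d + 2)
  set Kp : ℝ := max K 0 with hKp
  have hKp0 : 0 ≤ Kp := le_max_right _ _
  have hKK : K ≤ Kp := le_max_left _ _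
  refine ⟨2 * Kp + μ ^ 2, max (N₀ + 1) (max (N₁ + 1) 2), fun M hM => ?_⟩
  have hM2 : 2 ≤ M := le_trans (le_trans (le_max_right _ _) (le_max_right _ _)) hM
  have hN0 : N₀ ≤ 2 * M - 1 := by have := le_trans (le_max_left _ _) hM; omega
  have hN1 : N₁ ≤ 2 * M - 1 := by have := le_trans (le_trans (le_max_left _ _) (le_max_right _ _)) hM; omega
  have hpar : (2 * M - 1) % 2 = normOne (eNeg : Site (d + 2)) % 2 := by rw [normOne_eNeg]; omega
  -- positivity of `c_{2M-1}(0,-e₂)` from the lower envelope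
  have henv' := henv (2 * M - 1) hN1 hpar
  have hcposR : (0 : ℝ) < countAt (d + 2) (2 * M - 1) eNeg :=
    lt_of_lt_of_le (mul_pos (Real.exp_pos _) (pow_pos hμpos _)) henv'
  have hcpos : 0 < countAt (d + 2) (2 * M - 1) eNeg := by exact_mod_cast hcposR
  -- Kesten's endpoint rate at `N = 2M - 1`
  obtain ⟨hlo, hhi⟩ := hK (2 * M - 1) hN0 hpar
  have e2 : 2 * M - 1 + 2 = 2 * M + 1 := by omega
  rw [e2] at hlo hhi
  set R : ℝ := (countAt (d + 2) (2 * M + 1) eNeg : ℝ) / countAt (d + 2) (2 * M - 1) eNeg with hR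
  have hR0 : 0 ≤ R := div_nonneg (Nat.cast_nonneg _) (Nat.cast_nonneg _)
  rw [polygonNumber_ratio_eq M hM2 hcpos, ← hR]
  -- real-analysis bookkeeping
  have hMpos : (0 : ℝ) < M := by exact_mod_cast (show 0 < M by omega)
  have hM1 : (1 : ℝ) ≤ M := by exact_mod_cast (show 1 ≤ M by omega)
  have hNM : (M : ℝ) ≤ ((2 * M - 1 : ℕ) : ℝ) := by exact_mod_cast (show M ≤ 2 * M - 1 by omega)
  have hN1r : (1 : ℝ) ≤ ((2 * M - 1 : ℕ) : ℝ) := le_trans hM1 hNM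
  have hp3 : ((2 * M - 1 : ℕ) : ℝ) ^ (-(1 : ℝ) / 3) ≤ (M : ℝ) ^ (-(1 : ℝ) / 3) :=
    Real.rpow_le_rpow_of_nonpos hMpos hNM (by norm_num)
  have hp4 : ((2 * M - 1 : ℕ) : ℝ) ^ (-(1 : ℝ) / 4) ≤ (M : ℝ) ^ (-(1 : ℝ) / 4) :=
    Real.rpow_le_rpow_of_nonpos hMpos hNM (by norm_num)
  have hp4one : ((2 * M - 1 : ℕ) : ℝ) ^ (-(1 : ℝ) / 4) ≤ 1 := Real.rpow_le_one_of_one_le_of_nonpos hN1r (by norm_num)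
  have hM3 : 0 ≤ (M : ℝ) ^ (-(1 : ℝ) / 3) := Real.rpow_nonneg hMpos.le _
  have hM4 : 0 ≤ (M : ℝ) ^ (-(1 : ℝ) / 4) := Real.rpow_nonneg hMpos.le _
  -- `1/(M+1) ≤ M^{-1/3}`
  have hinv : 1 / ((M : ℝ) + 1) ≤ (M : ℝ) ^ (-(1 : ℝ) / 3) := by
    have h13 : (M : ℝ) ^ ((1 : ℝ) / 3) ≤ (M : ℝ) + 1 :=
      (Real.rpow_le_self_of_one_le hM1 (by norm_num)).trans (by linarith)
    have h13pos : 0 < (M : ℝ) ^ ((1 : ℝ) / 3) := Real.rpow_pos_of_pos hMpos _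
    rw [show (-(1 : ℝ) / 3) = -((1 : ℝ) / 3) by ring, Real.rpow_neg hMpos.le, ← one_div]
    exact one_div_le_one_div_of_le h13pos h13
  -- the prefactor `2M/(2M+2) = 1 - 1/(M+1)`
  have hpre : (2 * M : ℝ) / (2 * M + 2) = 1 - 1 / ((M : ℝ) + 1) := by
    field_simp; ring
  rw [hpre]
  have hKN3 : K * ((2 * M - 1 : ℕ) : ℝ) ^ (-(1 : ℝ) / 3) ≤ Kp * (M : ℝ) ^ (-(1 : ℝ) / 3) :=
    (mul_le_mul_of_nonneg_right hKK (Real.rpow_nonneg (by positivity) _)).trans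
      (mul_le_mul_of_nonneg_left hp3 hKp0)
  have hKN4 : K * ((2 * M - 1 : ℕ) : ℝ) ^ (-(1 : ℝ) / 4) ≤ Kp * (M : ℝ) ^ (-(1 : ℝ) / 4) :=
    (mul_le_mul_of_nonneg_right hKK (Real.rpow_nonneg (by positivity) _)).trans
      (mul_le_mul_of_nonneg_left hp4 hKp0)
  have hRle : R ≤ μ ^ 2 + Kp := by
    have : K * ((2 * M - 1 : ℕ) : ℝ) ^ (-(1 : ℝ) / 4) ≤ Kp * 1 :=
      (mul_le_mul_of_nonneg_right hKK (Real.rpow_nonneg (by positivity) _)).trans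
        (mul_le_mul_of_nonneg_left hp4one hKp0)
    linarith
  have hinv0 : 0 ≤ 1 / ((M : ℝ) + 1) := by positivity
  constructor
  · -- lower: `(1 - 1/(M+1)) R - μ² = (R - μ²) - R/(M+1) ≥ -Kp M^{-1/3} - (μ² + Kp) M^{-1/3}`
    have h1 : R * (1 / ((M : ℝ) + 1)) ≤ (μ ^ 2 + Kp) * (M : ℝ) ^ (-(1 : ℝ) / 3) :=
      (mul_le_mul hRle hinv hinv0 (by positivity))
    have hμ2 : 0 ≤ μ ^ 2 * (M : ℝ) ^ (-(1 : ℝ) / 4) := by positivity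
    nlinarith [hlo, hKN3, h1, hM3, hM4, hKp0]
  · -- upper: `(1 - 1/(M+1)) R - μ² ≤ R - μ² ≤ Kp M^{-1/4}`
    have h1 : (1 - 1 / ((M : ℝ) + 1)) * R ≤ R := by nlinarith [hR0, hinv0]
    nlinarith [hhi, hKN4, h1, hM3, hM4, hKp0, sq_nonneg μ]

/-- **Madras–Slade Theorem 7.3.4(c), every dimension, AS PRINTED**: "`lim_{N→∞} q_{2N+2}/q_{2N} = μ²`" on
`ℤ^{d+2}`, `q_N` the number of `N`-step self-avoiding polygons up to translation.
[cite: MadrasSlade1993, Theorem 7.3.4 (c) (p. 248)] -/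
theorem _root_.Literature.Probability.RandomPlanarGeometry.SAW.Zd.MadrasSlade1993_thm734c_allDim (d : ℕ) :
    Tendsto (fun M : ℕ =>
      (PolygonConcat.polygonNumber (d + 2) (2 * M + 2) : ℝ) / PolygonConcat.polygonNumber (d + 2) (2 * M))
      atTop (𝓝 (connectiveConstant (d + 2) ^ 2)) := by
  obtain ⟨K, M₀, hK⟩ := MadrasSlade1993_thm734c_rate d
  have h3 : Tendsto (fun M : ℕ => K * (M : ℝ) ^ (-(1 : ℝ) / 3)) atTop (𝓝 0) := by
    have := ((tendsto_rpow_neg_atTop (by norm_num : (0 : ℝ) < 1 / 3)).comp tendsto_natCast_atTop_atTop).const_mul K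
    rw [mul_zero] at this
    refine this.congr fun M => ?_
    simp only [Function.comp]
    rw [show (-(1 : ℝ) / 3) = -((1 : ℝ) / 3) by ring]
  have h4 : Tendsto (fun M : ℕ => K * (M : ℝ) ^ (-(1 : ℝ) / 4)) atTop (𝓝 0) := by
    have := ((tendsto_rpow_neg_atTop (by norm_num : (0 : ℝ) < 1 / 4)).comp tendsto_natCast_atTop_atTop).const_mul K
    rw [mul_zero] at this
    refine this.congr fun M => ?_
    simp only [Function.comp]
    rw [show (-(1 : ℝ) / 4) = -((1 : ℝ) / 4) by ring]
  have hsub : Tendsto (fun M : ℕ =>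
      (PolygonConcat.polygonNumber (d + 2) (2 * M + 2) : ℝ) / PolygonConcat.polygonNumber (d + 2) (2 * M) -
        connectiveConstant (d + 2) ^ 2) atTop (𝓝 0) := by
    refine tendsto_of_tendsto_of_tendsto_of_le_of_le' (by simpa using h3.neg) h4 ?_ ?_
    · filter_upwards [eventually_ge_atTop M₀] with M hM using (hK M hM).1
    · filter_upwards [eventually_ge_atTop M₀] with M hM using (hK M hM).2
  have := hsub.add_const (connectiveConstant (d + 2) ^ 2)
  simpa using this

end PolygonRatioZd

end Literature.Probability.RandomPlanarGeometry.SAW.Zd
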